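import Literature.NumberTheory.Automorphic.UnitaryLatticeTreeRootStarCount               -- ★ V2b (residual letters `hσO σk hσk` convention), brings ★ `residue_eq_zero_iff_v_lt_one`, `B₀`, `unitaryInt`
import Literature.NumberTheory.Automorphic.UnitaryThreeUnipotentFixedIsotropicUnique       -- ★ `exists_smul_of_isotropic_fixed` (+ ★ `exists_isotropic_fixed_of_isNilpotent`)
import HarnessLib

/-!
# R90 · S6 — LINE G1 «geometric fixed subtree», RUNG 1a DICTIONARY: THE REDUCTION `K₀ → U(σ̄, J₀)(𝓀)` AND THE UNIQUE ISOTROPIC EIGENLINE OF A RESIDUALLY UNIPOTENT ELEMENT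
# (`Theorems/R90S6ResidualUnitaryReduction.lean`)

Cell `hodgecm-mathlib`, crux H413 (`stmt-HodgeConjecture-24833`), route of record `HCCMUnconditional`; programme R90-TF, section S6 (base `R90-C14`), seat R90-C14-p07 (g0);
S6 dealer R90-C14-plan (g2) RULING 2026-09-05T00:29:12Z «p07 TAKES 3u-GENERAL = G1 rung 1a»; this is the PUBLIC DICTIONARY half of rung 1a (the sibling R90-C14-p05 (g0)
builds FILE 3c-A on it, ACK 00:30:22Z), the VALUE half is `Theorems/R90S6ResidualStarFixedUnipotent.lean`.  Helper lane `--supports stmt-HodgeConjecture-24833 --as helper`;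
THEOREMS ONLY (no definition, no instance, no notation, no named fact, no `sorry`); imports = ★ `UnitaryLatticeTreeRootStarCount` (V2b) + ★ `UnitaryThreeUnipotentFixedIsotropicUnique` + HarnessLib.

THE MATHEMATICS [BruhatTits1972, §10; Tits1979, §3.5; Wilson2009, §3.6.1; Rogawski1990, §3.9 p. 32; Serre1979, Ch. I §7].  `K` a valued field (`Valued K ℤᵐ⁰`), `σ : K →+* K`,
`U = U(σ, J₀)(K)` (★ `unitaryGroupOfForm`), `K₀ = unitaryInt` (`U ∩ GL₃(𝒪)`, inverse integral), `𝓀 = 𝒪/𝔪`, `B₀ σ 3 x y = σx₀·y₂ + σx₁·y₁ + σx₂·y₀`.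
* §1 THE REDUCTION DICTIONARY `𝒪³ → 𝓀³` (integral vectors as `Fin 3 → 𝒪[K]`): residues commute with `B₀`, `mulVec`, scalars (`residue_vec_eq_zero_iff`, `residue_vec_eq_smul_iff`,
  `B₀_coe_mem_integer`, `residue_B₀_eq`, `coe_mulVec_eq`, `residue_mulVec_eq`).
* §2 THE RESIDUAL UNITARY ELEMENT: for `k ∈ K₀` (and residual letters `hσO σk hσk`) the reduction `k̄ ∈ GL₃(𝓀)` lies in `U(σ̄, J₀)(𝓀)`, with entries the residues of the
  entries of `k` (`exists_residual_unitary`; `map_coe_intMatrix_of_mem_unitaryInt`).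
* §3 RESIDUAL FIELD LEMMAS (any field `k`, `τ : k →+* k`): the single eigenvalue `c` of a unitary `g` with `(g − c)³ = 0` has norm `τc·c = 1`
  (`map_mul_self_eq_one_of_mem_unitaryGroupOfForm_of_pow_three` — eigen-covector argument: `φ = B₀ x _` for an eigenvector `x` satisfies `φ ∘ (g − c) = ((τc)⁻¹ − c)·φ`, so
  `((τc)⁻¹ − c)³ φ = 0`, `φ ≠ 0` by non-degeneracy); hence for `τ` an involution and `g ≠ c`, `u = c⁻¹g ≠ 1` is a unipotent element of `U(τ, J₀)` and `g` has EXACTLY ONE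
  isotropic eigenline (`exists_isotropic_eigenvector_unique_of_pow_three` ← ★ `exists_isotropic_fixed_of_isNilpotent` + ★ `exists_smul_of_isotropic_fixed`, both nilpotency ranks).
* §4 THE RESIDUAL CONJUGATION AND RESIDUAL NILPOTENCY: if `σ` preserves the valuation and is an involution it preserves `𝒪` and induces an involution `σ̄` of `𝓀` compatible
  with residues (`exists_residualConjugation` — the cell's residual letters `hσO σk hσk` DISCHARGED from `hd.vσ`, `hd.σσ`); `res (c·1) = c̄·1` (`residue_mapMatrix_smul_one`,
  `subtype_mapMatrix_smul_one`); `(k − c·1)³ ≡ 0 (mod 𝔪)` entrywise gives `(k̄ − c̄·1)³ = 0` (`residue_sub_smul_one_pow_three_eq_zero`).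
HONEST LABEL: residual linear algebra, count-neutral (a dictionary); consumed by `R90S6ResidualStarFixedUnipotent` (rung 1a value) and rung 1; proves no printed statement.
HC_CM is proved only modulo the 7 printed citations (2 remaining named inputs: hLiu418 = stmt-HodgeConjecture-24832, h413 = stmt-HodgeConjecture-24833) until rung 0 closes.

## References
* [BruhatTits1972] F. Bruhat, J. Tits, *Groupes réductifs sur un corps local I*, Publ. Math. IHÉS 41 (1972), §10.
* [Tits1979] J. Tits, *Reductive groups over local fields*, PSPM 33.1 (1979), §3.5 (the star of a hyperspecial vertex = the residual building).
* [Wilson2009] R. A. Wilson, *The Finite Simple Groups*, GTM 251 (2009), §3.6.1 p. 67 (unitary transvections, stabiliser of an isotropic point).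
* [Rogawski1990] J. D. Rogawski, *Automorphic Representations of Unitary Groups in Three Variables*, Ann. of Math. Stud. 123 (1990), §3.9 p. 32.
* [Serre1979] J.-P. Serre, *Local Fields*, GTM 67 (1979), Ch. I §7 (residue field functoriality).
-/
set_option autoImplicit false
-- the mandated namespace repeats the single-problem summit's segment (`HodgeConjecture.HodgeConjecture`)
set_option linter.dupNamespace false

noncomputable section

open Literature.NumberTheory.Automorphic Literature.NumberTheory.Automorphic.HermitianLattice Literature.NumberTheory.Automorphic.UnitaryGroup
open Literature.NumberTheory.Automorphic.UnitaryLatticeTree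
open scoped Matrix MatrixGroups WithZero Valued

namespace Summit.HodgeConjecture.HodgeConjecture.R90.S6

variable {K : Type*} [Field K] [Valued K ℤᵐ⁰] {σ : K →+* K}

/-! ### §1 The reduction dictionary `𝒪³ → 𝓀³` (integral vectors as `Fin 3 → 𝒪[K]`) -/

/-- Residues of an integral vector vanish iff all its coordinates lie in the maximal ideal. [folklore] -/
theorem residue_vec_eq_zero_iff (X : Fin 3 → 𝒪[K]) :
    (fun i => IsLocalRing.residue 𝒪[K] (X i)) = 0 ↔ ∀ i, Valued.v ((X i : K)) < 1 := by
  simp only [funext_iff, Pi.zero_apply, residue_eq_zero_iff_v_lt_one]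

/-- `X ≡ c·X′ (mod 𝔪)` iff the residual vectors satisfy `X̄ = c̄ • X̄′`. [folklore] -/
theorem residue_vec_eq_smul_iff (X X' : Fin 3 → 𝒪[K]) (c : 𝒪[K]) :
    (fun i => IsLocalRing.residue 𝒪[K] (X i)) = IsLocalRing.residue 𝒪[K] c • (fun i => IsLocalRing.residue 𝒪[K] (X' i)) ↔
      ∀ i, Valued.v ((X i : K) - c * X' i) < 1 := by
  simp only [funext_iff, Pi.smul_apply, smul_eq_mul]
  refine forall_congr' fun i => ?_
  rw [← sub_eq_zero, ← map_mul, ← map_sub, residue_eq_zero_iff_v_lt_one]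
  rfl

/-- The hermitian form of two integral vectors is integral (`σ` preserving `𝒪`). [folklore] -/
theorem B₀_coe_mem_integer (hσO : ∀ x : 𝒪[K], σ x ∈ 𝒪[K]) (X Y : Fin 3 → 𝒪[K]) :
    B₀ σ 3 (fun i => (X i : K)) (fun i => (Y i : K)) ∈ 𝒪[K] := by
  have h : B₀ σ 3 (fun i => (X i : K)) (fun i => (Y i : K)) = ((∑ i, (⟨σ (X i), hσO (X i)⟩ : 𝒪[K]) * Y (Fin.rev i) : 𝒪[K]) : K) := by
    rw [B₀_apply]; push_cast; rfl
  rw [h]; exact SetLike.coe_mem _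

/-- Residues commute with the hermitian form: `res (B₀ σ X Y) = B₀ σ̄ X̄ Ȳ`. [folklore] -/
theorem residue_B₀_eq (hσO : ∀ x : 𝒪[K], σ x ∈ 𝒪[K]) (σk : 𝓀[K] →+* 𝓀[K])
    (hσk : ∀ x : 𝒪[K], IsLocalRing.residue 𝒪[K] ⟨σ x, hσO x⟩ = σk (IsLocalRing.residue 𝒪[K] x)) (X Y : Fin 3 → 𝒪[K]) :
    IsLocalRing.residue 𝒪[K] ⟨B₀ σ 3 (fun i => (X i : K)) (fun i => (Y i : K)), B₀_coe_mem_integer hσO X Y⟩ =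
      B₀ σk 3 (fun i => IsLocalRing.residue 𝒪[K] (X i)) (fun i => IsLocalRing.residue 𝒪[K] (Y i)) := by
  have hcoe : (⟨B₀ σ 3 (fun i => (X i : K)) (fun i => (Y i : K)), B₀_coe_mem_integer hσO X Y⟩ : 𝒪[K]) =
      ∑ i, (⟨σ (X i), hσO (X i)⟩ : 𝒪[K]) * Y (Fin.rev i) := by
    apply Subtype.ext
    show B₀ σ 3 (fun i => (X i : K)) (fun i => (Y i : K)) = _
    rw [B₀_apply]; push_cast; rfl
  rw [hcoe, map_sum, B₀_apply]
  exact Finset.sum_congr rfl fun i _ => by rw [map_mul, hσk]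

/-- `mulVec` of an integral matrix and an integral vector, in `𝒪`-letters. [folklore] -/
theorem coe_mulVec_eq (kO : Matrix (Fin 3) (Fin 3) 𝒪[K]) (X : Fin 3 → 𝒪[K]) :
    (fun i => ((kO *ᵥ X) i : K)) = (kO.map ((↑) : 𝒪[K] → K)) *ᵥ (fun i => (X i : K)) := by
  funext i
  simp only [Matrix.mulVec, dotProduct, Matrix.map_apply]
  push_cast
  rfl

/-- Residues commute with `mulVec`: `res (kO X) = k̄ X̄`. [folklore] -/
theorem residue_mulVec_eq (kO : Matrix (Fin 3) (Fin 3) 𝒪[K]) (X : Fin 3 → 𝒪[K]) :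
    (fun i => IsLocalRing.residue 𝒪[K] ((kO *ᵥ X) i)) = kO.map (IsLocalRing.residue 𝒪[K]) *ᵥ (fun i => IsLocalRing.residue 𝒪[K] (X i)) := by
  funext i
  simp only [Matrix.mulVec, dotProduct, Matrix.map_apply, map_sum, map_mul]

/-! ### §2 The residual unitary group element `k̄ ∈ U(σ̄, J₀)(𝓀)` of `k ∈ K₀` -/

/-- The integral matrix of `k ∈ K₀ = U ∩ GL₃(𝒪)` (entries bundled in `𝒪`) maps to `k` under the coercion. [folklore] -/
theorem map_coe_intMatrix_of_mem_unitaryInt {k : ↥(unitaryGroupOfForm σ ((StdForm.antidiagonal 3).over K))}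
    (hk : k ∈ unitaryInt σ ((StdForm.antidiagonal 3).over K)) :
    (Matrix.of fun i j => (⟨((k : GL (Fin 3) K) : Matrix (Fin 3) (Fin 3) K) i j, (mem_unitaryInt_iff.1 hk).1 i j⟩ : 𝒪[K])).map
        ((↑) : 𝒪[K] → K) = ((k : GL (Fin 3) K) : Matrix (Fin 3) (Fin 3) K) := by
  ext i j; rfl

/-- **THE RESIDUAL UNITARY ELEMENT.**  For `k ∈ K₀` (and the residual letters `hσO σk hσk` of ★ V2b) there is `k̄ ∈ GL₃(𝓀)` lying in `U(σ̄, J₀)(𝓀)` whose entries are the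
residues of the entries of `k` (its inverse's entries the residues of those of `k⁻¹`). [cite: BruhatTits1972, §10] [cite: Tits1979, §3.5] -/
theorem exists_residual_unitary (hσO : ∀ x : 𝒪[K], σ x ∈ 𝒪[K]) (σk : 𝓀[K] →+* 𝓀[K])
    (hσk : ∀ x : 𝒪[K], IsLocalRing.residue 𝒪[K] ⟨σ x, hσO x⟩ = σk (IsLocalRing.residue 𝒪[K] x))
    {k : ↥(unitaryGroupOfForm σ ((StdForm.antidiagonal 3).over K))} (hk : k ∈ unitaryInt σ ((StdForm.antidiagonal 3).over K)) :
    ∃ kb : GL (Fin 3) 𝓀[K], kb ∈ unitaryGroupOfForm σk ((StdForm.antidiagonal 3).over 𝓀[K]) ∧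
      (∀ i j, (kb : Matrix (Fin 3) (Fin 3) 𝓀[K]) i j =
        IsLocalRing.residue 𝒪[K] ⟨((k : GL (Fin 3) K) : Matrix (Fin 3) (Fin 3) K) i j, (mem_unitaryInt_iff.1 hk).1 i j⟩) ∧
      ∀ i j, ((kb⁻¹ : GL (Fin 3) 𝓀[K]) : Matrix (Fin 3) (Fin 3) 𝓀[K]) i j =
        IsLocalRing.residue 𝒪[K] ⟨(((k : GL (Fin 3) K)⁻¹ : GL (Fin 3) K) : Matrix (Fin 3) (Fin 3) K) i j, (mem_unitaryInt_iff.1 hk).2 i j⟩ := by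
  -- the integral matrices of `k` and `k⁻¹`
  set kO : Matrix (Fin 3) (Fin 3) 𝒪[K] :=
    Matrix.of fun i j => (⟨((k : GL (Fin 3) K) : Matrix (Fin 3) (Fin 3) K) i j, (mem_unitaryInt_iff.1 hk).1 i j⟩ : 𝒪[K]) with hkO
  set kO' : Matrix (Fin 3) (Fin 3) 𝒪[K] :=
    Matrix.of fun i j => (⟨(((k : GL (Fin 3) K)⁻¹ : GL (Fin 3) K) : Matrix (Fin 3) (Fin 3) K) i j, (mem_unitaryInt_iff.1 hk).2 i j⟩ : 𝒪[K]) with hkO'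
  have hC : Function.Injective ((𝒪[K].subtype).mapMatrix : Matrix (Fin 3) (Fin 3) 𝒪[K] →+* Matrix (Fin 3) (Fin 3) K) :=
    fun A B h => Matrix.ext fun i j => Subtype.ext (by have := congrArg (fun M : Matrix (Fin 3) (Fin 3) K => M i j) h; simpa using this)
  have hCk : (𝒪[K].subtype).mapMatrix kO = ((k : GL (Fin 3) K) : Matrix (Fin 3) (Fin 3) K) := by ext i j; rfl
  have hCk' : (𝒪[K].subtype).mapMatrix kO' = (((k : GL (Fin 3) K)⁻¹ : GL (Fin 3) K) : Matrix (Fin 3) (Fin 3) K) := by ext i j; rfl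
  have h1 : kO * kO' = 1 := hC (by rw [map_mul, map_one, hCk, hCk', ← Units.val_mul, mul_inv_cancel, Units.val_one])
  have h2 : kO' * kO = 1 := hC (by rw [map_mul, map_one, hCk, hCk', ← Units.val_mul, inv_mul_cancel, Units.val_one])
  refine ⟨⟨(IsLocalRing.residue 𝒪[K]).mapMatrix kO, (IsLocalRing.residue 𝒪[K]).mapMatrix kO',
    by rw [← map_mul, h1, map_one], by rw [← map_mul, h2, map_one]⟩, ?_, fun i j => rfl, fun i j => rfl⟩
  -- unitarity: test on lifts of residual vectors
  rw [mem_unitaryGroupOfForm_antidiagonal_iff]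
  intro u v
  obtain ⟨U, hU⟩ : ∃ U : Fin 3 → 𝒪[K], (fun i => IsLocalRing.residue 𝒪[K] (U i)) = u :=
    ⟨fun i => (IsLocalRing.residue_surjective (u i)).choose, funext fun i => (IsLocalRing.residue_surjective (u i)).choose_spec⟩
  obtain ⟨V, hV⟩ : ∃ V : Fin 3 → 𝒪[K], (fun i => IsLocalRing.residue 𝒪[K] (V i)) = v :=
    ⟨fun i => (IsLocalRing.residue_surjective (v i)).choose, funext fun i => (IsLocalRing.residue_surjective (v i)).choose_spec⟩
  rw [← hU, ← hV]
  change B₀ σk 3 (kO.map (IsLocalRing.residue 𝒪[K]) *ᵥ fun i => IsLocalRing.residue 𝒪[K] (U i))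
      (kO.map (IsLocalRing.residue 𝒪[K]) *ᵥ fun i => IsLocalRing.residue 𝒪[K] (V i)) = _
  rw [← residue_mulVec_eq, ← residue_mulVec_eq, ← residue_B₀_eq hσO σk hσk, ← residue_B₀_eq hσO σk hσk]
  congr 1
  apply Subtype.ext
  show B₀ σ 3 (fun i => ((kO *ᵥ U) i : K)) (fun i => ((kO *ᵥ V) i : K)) = B₀ σ 3 (fun i => (U i : K)) (fun i => (V i : K))
  rw [coe_mulVec_eq, coe_mulVec_eq, map_coe_intMatrix_of_mem_unitaryInt hk]
  exact (mem_unitaryGroupOfForm_antidiagonal_iff (k : GL (Fin 3) K)).1 k.2 _ _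

/-! ### §3 Residual field lemmas (any field `k`, any ring endomorphism `τ`) -/

/-- **The eigenvalue of a unitary element with a single eigenvalue has norm one**: if `g ∈ U(τ, J₀)(k)` and `(g − c·1)³ = 0` with `c ≠ 0`, then `τ c · c = 1`.  (An eigenvector
`x ≠ 0`, `g x = c x`, gives `B₀ x y = τc · B₀ x (g y)`, so the functional `B₀ x _` satisfies `φ((g − c) y) = ((τ c)⁻¹ − c) φ(y)`; iterating thrice, `((τ c)⁻¹ − c)³ φ = 0`,
and `φ ≠ 0` by non-degeneracy.) [cite: Wilson2009, §3.6.1 p. 67] -/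
theorem map_mul_self_eq_one_of_mem_unitaryGroupOfForm_of_pow_three {k : Type*} [Field k] (τ : k →+* k) {g : GL (Fin 3) k}
    (hg : g ∈ unitaryGroupOfForm τ ((StdForm.antidiagonal 3).over k)) {c : k} (hc : c ≠ 0)
    (h3 : ((g : Matrix (Fin 3) (Fin 3) k) - c • (1 : Matrix (Fin 3) (Fin 3) k)) ^ 3 = 0) : τ c * c = 1 := by
  set T : Matrix (Fin 3) (Fin 3) k := (g : Matrix (Fin 3) (Fin 3) k) - c • (1 : Matrix (Fin 3) (Fin 3) k) with hT
  -- an eigenvector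
  have hdet : T.det = 0 := by
    have h := congrArg Matrix.det h3
    rw [Matrix.det_pow, Matrix.det_zero] at h
    exact (pow_eq_zero_iff three_ne_zero).1 h
  obtain ⟨x, hx0, hx⟩ := Matrix.exists_mulVec_eq_zero_iff.2 hdet
  have hgx : (g : Matrix (Fin 3) (Fin 3) k) *ᵥ x = c • x := by
    have : T *ᵥ x = (g : Matrix (Fin 3) (Fin 3) k) *ᵥ x - c • x := by
      rw [hT, Matrix.sub_mulVec, Matrix.smul_mulVec, Matrix.one_mulVec]
    rw [this, sub_eq_zero] at hx
    exact hx
  have hu := (mem_unitaryGroupOfForm_antidiagonal_iff g).1 hg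
  -- `φ (g y) = (τ c)⁻¹ φ y`
  have hτc : τ c ≠ 0 := (map_ne_zero τ).2 hc
  have hφ : ∀ y, B₀ τ 3 x ((g : Matrix (Fin 3) (Fin 3) k) *ᵥ y) = (τ c)⁻¹ * B₀ τ 3 x y := by
    intro y
    have h := hu x y
    rw [hgx, LinearMap.map_smulₛₗ, LinearMap.smul_apply, smul_eq_mul] at h
    rw [← h, inv_mul_cancel_left₀ hτc]
  -- `φ (T y) = ((τ c)⁻¹ - c) φ y`
  have hφT : ∀ y, B₀ τ 3 x (T *ᵥ y) = ((τ c)⁻¹ - c) * B₀ τ 3 x y := by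
    intro y
    rw [hT, Matrix.sub_mulVec, Matrix.smul_mulVec, Matrix.one_mulVec, map_sub, map_smul, smul_eq_mul, hφ, sub_mul]
  have hφ3 : ∀ y, ((τ c)⁻¹ - c) ^ 3 * B₀ τ 3 x y = 0 := by
    intro y
    have h : B₀ τ 3 x (T ^ 3 *ᵥ y) = 0 := by rw [h3, Matrix.zero_mulVec, map_zero]
    rw [pow_succ, pow_two, ← Matrix.mulVec_mulVec, ← Matrix.mulVec_mulVec, hφT, hφT, hφT] at h
    linear_combination h
  by_contra hne
  have hd : (τ c)⁻¹ - c ≠ 0 := by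
    intro h0
    apply hne
    rw [sub_eq_zero] at h0
    calc τ c * c = τ c * (τ c)⁻¹ := by rw [h0]
      _ = 1 := mul_inv_cancel₀ hτc
  apply hx0
  funext i
  have h := hφ3 (Pi.single (Fin.rev i) 1)
  rw [B₀_single_right, Fin.rev_rev, mul_eq_zero, or_iff_right (pow_ne_zero 3 hd), map_eq_zero_iff τ τ.injective] at h
  exact h

/-- **A unitary `g` with `(g − c·1)³ = 0`, `g ≠ c·1` has EXACTLY ONE isotropic eigenline** (`τ` an involution): normalising by the norm-one scalar `c`
(`map_mul_self_eq_one_of_mem_unitaryGroupOfForm_of_pow_three`), `u = c⁻¹g ≠ 1` is a unipotent element of `U(τ, J₀)`, which fixes a non-zero isotropic vector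
(★ `exists_isotropic_fixed_of_isNilpotent`) and every fixed isotropic vector is a multiple of it (★ `exists_smul_of_isotropic_fixed`). [cite: Wilson2009, §3.6.1 p. 67]
[cite: Rogawski1990, §3.9 p. 32] -/
theorem exists_isotropic_eigenvector_unique_of_pow_three {k : Type*} [Field k] (τ : k →+* k) (hτ : ∀ z, τ (τ z) = z) {g : GL (Fin 3) k}
    (hg : g ∈ unitaryGroupOfForm τ ((StdForm.antidiagonal 3).over k)) {c : k} (hc : c ≠ 0)
    (h3 : ((g : Matrix (Fin 3) (Fin 3) k) - c • (1 : Matrix (Fin 3) (Fin 3) k)) ^ 3 = 0) (hne : (g : Matrix (Fin 3) (Fin 3) k) ≠ c • (1 : Matrix (Fin 3) (Fin 3) k)) :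
    ∃ v : Fin 3 → k, v ≠ 0 ∧ (g : Matrix (Fin 3) (Fin 3) k) *ᵥ v = c • v ∧ B₀ τ 3 v v = 0 ∧
      ∀ w : Fin 3 → k, (g : Matrix (Fin 3) (Fin 3) k) *ᵥ w = c • w → B₀ τ 3 w w = 0 → ∃ a : k, w = a • v := by
  have hN := map_mul_self_eq_one_of_mem_unitaryGroupOfForm_of_pow_three τ hg hc h3
  have hτc : τ c = c⁻¹ := eq_inv_of_mul_eq_one_left hN
  have hGG' : (g : Matrix (Fin 3) (Fin 3) k) * ((g⁻¹ : GL (Fin 3) k) : Matrix (Fin 3) (Fin 3) k) = 1 := by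
    rw [← Units.val_mul, mul_inv_cancel, Units.val_one]
  have hG'G : ((g⁻¹ : GL (Fin 3) k) : Matrix (Fin 3) (Fin 3) k) * (g : Matrix (Fin 3) (Fin 3) k) = 1 := by
    rw [← Units.val_mul, inv_mul_cancel, Units.val_one]
  -- the normalised element `u = c⁻¹ g`
  let u : GL (Fin 3) k := ⟨c⁻¹ • (g : Matrix (Fin 3) (Fin 3) k), c • ((g⁻¹ : GL (Fin 3) k) : Matrix (Fin 3) (Fin 3) k),
    by rw [Matrix.smul_mul, Matrix.mul_smul, smul_smul, inv_mul_cancel₀ hc, one_smul, hGG'],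
    by rw [Matrix.smul_mul, Matrix.mul_smul, smul_smul, mul_inv_cancel₀ hc, one_smul, hG'G]⟩
  have hucoe : (u : Matrix (Fin 3) (Fin 3) k) = c⁻¹ • (g : Matrix (Fin 3) (Fin 3) k) := rfl
  have hu : u ∈ unitaryGroupOfForm τ ((StdForm.antidiagonal 3).over k) := by
    rw [mem_unitaryGroupOfForm_antidiagonal_iff]
    intro x y
    rw [hucoe, Matrix.smul_mulVec, Matrix.smul_mulVec, LinearMap.map_smulₛₗ₂, map_smul, smul_eq_mul, smul_eq_mul,
      (mem_unitaryGroupOfForm_antidiagonal_iff g).1 hg x y, map_inv₀, hτc, inv_inv, ← mul_assoc, mul_inv_cancel₀ hc, one_mul]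
  have hnil : IsNilpotent ((u : Matrix (Fin 3) (Fin 3) k) - 1) := by
    refine ⟨3, ?_⟩
    have h : (u : Matrix (Fin 3) (Fin 3) k) - 1 = c⁻¹ • ((g : Matrix (Fin 3) (Fin 3) k) - c • (1 : Matrix (Fin 3) (Fin 3) k)) := by
      rw [hucoe, smul_sub, smul_smul, inv_mul_cancel₀ hc, one_smul]
    rw [h, smul_pow, h3, smul_zero]
  have h1 : u ≠ 1 := by
    intro hu1
    apply hne
    have h : (u : Matrix (Fin 3) (Fin 3) k) = 1 := by rw [hu1, Units.val_one]
    rw [hucoe] at h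
    calc (g : Matrix (Fin 3) (Fin 3) k) = c • (c⁻¹ • (g : Matrix (Fin 3) (Fin 3) k)) := by rw [smul_smul, mul_inv_cancel₀ hc, one_smul]
      _ = c • 1 := by rw [h]
  -- `u w = w ↔ g w = c w`
  have hfix : ∀ w : Fin 3 → k, (u : Matrix (Fin 3) (Fin 3) k) *ᵥ w = w ↔ (g : Matrix (Fin 3) (Fin 3) k) *ᵥ w = c • w := by
    intro w
    rw [hucoe, Matrix.smul_mulVec]
    constructor
    · intro h
      calc (g : Matrix (Fin 3) (Fin 3) k) *ᵥ w = c • (c⁻¹ • ((g : Matrix (Fin 3) (Fin 3) k) *ᵥ w)) := by rw [smul_smul, mul_inv_cancel₀ hc, one_smul]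
        _ = c • w := by rw [h]
    · intro h
      rw [h, smul_smul, inv_mul_cancel₀ hc, one_smul]
  obtain ⟨v, hv0, hvfix, hviso⟩ := exists_isotropic_fixed_of_isNilpotent τ hu hnil h1
  refine ⟨v, hv0, (hfix v).1 hvfix, hviso, fun w hw hwiso => ?_⟩
  exact exists_smul_of_isotropic_fixed τ hτ hu hnil h1 hv0 hviso hvfix hwiso ((hfix w).2 hw)

/-! ### §4 The residual conjugation `σ̄` of an unramified datum, and residual nilpotency -/

/-- **The residual conjugation.**  If `σ` preserves the valuation and is an involution, it preserves `𝒪` and induces an involution `σ̄ : 𝓀 →+* 𝓀` of the residue field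
compatible with residues (the cell's residual letters `hσO σk hσk` of ★ V2b, DISCHARGED). [cite: Serre1979, Ch. I §7] [folklore] -/
theorem exists_residualConjugation (hvσ : ∀ x, Valued.v (σ x) = Valued.v x) (hσσ : ∀ x, σ (σ x) = x) :
    ∃ (hσO : ∀ x : 𝒪[K], σ x ∈ 𝒪[K]) (σk : 𝓀[K] →+* 𝓀[K]),
      (∀ x : 𝒪[K], IsLocalRing.residue 𝒪[K] ⟨σ x, hσO x⟩ = σk (IsLocalRing.residue 𝒪[K] x)) ∧ ∀ z, σk (σk z) = z := by
  have hσO : ∀ x : 𝒪[K], σ x ∈ 𝒪[K] := fun x =>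
    (Valuation.mem_integer_iff _ _).2 (by rw [hvσ]; exact (Valuation.mem_integer_iff _ _).1 x.2)
  let σO : 𝒪[K] →+* 𝒪[K] := (σ.comp 𝒪[K].subtype).codRestrict 𝒪[K] fun x => hσO x
  have hσOapp : ∀ x : 𝒪[K], σO x = ⟨σ x, hσO x⟩ := fun x => rfl
  haveI : IsLocalHom σO := ⟨fun x hx => by
    rw [CartanUnique.isUnit_integer_iff] at hx ⊢
    rw [hσOapp] at hx
    change Valued.v (σ (x : K)) = 1 at hx
    rwa [hvσ] at hx⟩
  refine ⟨hσO, IsLocalRing.ResidueField.map σO, fun x => ?_, fun z => ?_⟩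
  · rw [IsLocalRing.ResidueField.map_residue, hσOapp]
  · obtain ⟨x, rfl⟩ := IsLocalRing.residue_surjective z
    rw [IsLocalRing.ResidueField.map_residue, IsLocalRing.ResidueField.map_residue, hσOapp, hσOapp]
    exact congrArg _ (Subtype.ext (hσσ x))

/-- Reduction of scalar matrices: `res (c • 1) = c̄ • 1`. [folklore] -/
theorem residue_mapMatrix_smul_one (cO : 𝒪[K]) :
    (IsLocalRing.residue 𝒪[K]).mapMatrix (cO • (1 : Matrix (Fin 3) (Fin 3) 𝒪[K])) =
      IsLocalRing.residue 𝒪[K] cO • (1 : Matrix (Fin 3) (Fin 3) 𝓀[K]) := by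
  ext i j
  rw [RingHom.mapMatrix_apply, Matrix.map_apply, Matrix.smul_apply, Matrix.smul_apply, Matrix.one_apply, Matrix.one_apply, smul_eq_mul, smul_eq_mul,
    map_mul]
  split_ifs
  · rw [map_one]
  · rw [map_zero]

/-- Coercion of scalar matrices: `↑(c • 1) = c • 1`. [folklore] -/
theorem subtype_mapMatrix_smul_one (cO : 𝒪[K]) :
    (𝒪[K].subtype).mapMatrix (cO • (1 : Matrix (Fin 3) (Fin 3) 𝒪[K])) = (cO : K) • (1 : Matrix (Fin 3) (Fin 3) K) := by
  ext i j
  rw [RingHom.mapMatrix_apply, Matrix.map_apply, Matrix.smul_apply, Matrix.smul_apply, Matrix.one_apply, Matrix.one_apply, smul_eq_mul, smul_eq_mul,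
    map_mul]
  split_ifs
  · rw [map_one]; rfl
  · rw [map_zero]; rfl

/-- **Residual nilpotency**: if every entry of `(k − c·1)³` (integral letters) lies in `𝔪`, then `(k̄ − c̄·1)³ = 0` over `𝓀`. [folklore] -/
theorem residue_sub_smul_one_pow_three_eq_zero (kO : Matrix (Fin 3) (Fin 3) 𝒪[K]) (cO : 𝒪[K])
    (h : ∀ i j, Valued.v ((((kO - cO • (1 : Matrix (Fin 3) (Fin 3) 𝒪[K])) ^ 3) i j : K)) < 1) :
    (kO.map (IsLocalRing.residue 𝒪[K]) - IsLocalRing.residue 𝒪[K] cO • (1 : Matrix (Fin 3) (Fin 3) 𝓀[K])) ^ 3 = 0 := by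
  have h1 : kO.map (IsLocalRing.residue 𝒪[K]) - IsLocalRing.residue 𝒪[K] cO • (1 : Matrix (Fin 3) (Fin 3) 𝓀[K]) =
      (IsLocalRing.residue 𝒪[K]).mapMatrix (kO - cO • 1) := by
    rw [map_sub, residue_mapMatrix_smul_one]; rfl
  rw [h1, ← map_pow]
  ext i j
  rw [RingHom.mapMatrix_apply, Matrix.map_apply, Matrix.zero_apply, residue_eq_zero_iff_v_lt_one]
  exact h i j

end Summit.HodgeConjecture.HodgeConjecture.R90.S6

end
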